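import Mathlib
import HarnessLib
import Summits.ResolutionOfSingularities.Statement

/-!
# Proposed item signature for the promoted stub of crux `FRationalModification`
(stmt-ResolutionOfSingularities-15316, line `birth` v5, lead c6, cycle 7, 2026-08-17)

`PointwiseCertifiedModification` — the WEAKEST statement the line has proved sufficient for the crux
(chain D, tree `Theorems/FrobeniusLadderFRationalModificationPointwiseHull.lean`,
`PointwiseHull.fRationalModification_of_pointwiseHullOfRungTwo`, sorry-free, NO named fact), written in
crux style (all instance hypotheses as explicit arrows) over EXACTLY the route file's imports
(`Mathlib`, `HarnessLib`, `Summits.ResolutionOfSingularities.Statement`): this file elaborates as is, so the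
`def` body below can be filed verbatim as a route statement item (`ledger route edit … --add-item`), after
which `FRationalModification` closes by the 3-line adapter of `PromoteAdapter.lean`.

Informal: for every prime `p`, field `k` of characteristic `p` and INTEGRAL separated finite-type `Y/k`
all of whose local rings are rung-2 (domains in which every system of parameters is a weakly regular
sequence generating a Frobenius-closed ideal — `Y` Cohen–Macaulay and F-injective), there is a proper
birational `π : W' → Y` such that every local ring `𝒪 = 𝒪_{W',w}` is EITHER regular OR a domain carrying
a ring certificate: some `t ∈ 𝔪_𝒪 ∖ 0` with `𝒪[1/t]` a regular ring and `𝒪/(t)` Cohen–Macaulay and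
F-injective (rung-2 clause of `𝒪/(t)`). ("F-pure Cartier boundary pair model, pointwise form".)

Position: summit ⇒ item (a resolution: every stalk regular) ⇒ crux (chain D) ; item ⇐ each of the
line's Cartier-hull forms (chains A/B/C, tree `PointwiseHull.pointwiseHullOfRungTwo_of_hullOfRungTwo`,
`HullOfRungTwo.hullOfRungTwo_of_noCM`, `MacaulayfyHull`); NOT known to follow from the crux (an
F-rational — even F-regular — singular point need not carry a certificate: rational double points of
type `D`, `E`; so the item is not the crux in costume); open in dimension ≥ 4 (nothing in print produces
such models by modification), dimension ≤ 1 by normalisation, ≤ 3 under Cossart–Piltant.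
-/

-- single-problem summit: the doubled namespace component is forced
set_option linter.dupNamespace false

namespace Summit.ResolutionOfSingularities.ResolutionOfSingularities.Cruxes.FRationalModification.Promote

/-- PROPOSED ITEM (promotion of line `birth`'s open stub, weakest sufficient form, chain D):
**pointwise-certified modification of Cohen–Macaulay F-injective varieties.** For every prime `p`, field
`k` of characteristic `p` and integral separated finite-type `Y/k` with rung-2 local rings (domain; every
system of parameters a weakly regular sequence generating a Frobenius-closed ideal), there is a proper
birational `W' → Y` every local ring of which is regular or a domain with a ring certificate `t`
(`t ∈ 𝔪 ∖ 0`, `𝒪[1/t]` regular, `𝒪/(t)` Cohen–Macaulay with Frobenius-closed parameter ideals).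
[cite: FedderWatanabe1989, Prop. 2.13 (the consumer); card finj-exceptional-divisor-inversion (D+)] -/
def PointwiseCertifiedModification : Prop :=
  ∀ p : ℕ, p.Prime → ∀ (k : Type) [Field k] [CharP k p] (Y : AlgebraicGeometry.Scheme.{0}) (g : Y ⟶ AlgebraicGeometry.Spec (.of k)), AlgebraicGeometry.IsSeparated g → AlgebraicGeometry.LocallyOfFiniteType g → AlgebraicGeometry.QuasiCompact g → AlgebraicGeometry.IsIntegral Y → (∀ y : Y, IsDomain (Y.presheaf.stalk y) ∧ ∀ d : ℕ, ringKrullDim (Y.presheaf.stalk y) = d → ∀ s : Fin d → Y.presheaf.stalk y, (Ideal.span (Set.range s)).radical.IsMaximal → RingTheory.Sequence.IsWeaklyRegular (Y.presheaf.stalk y) (List.ofFn s) ∧ ∀ w : Y.presheaf.stalk y, (∃ e : ℕ, w ^ p ^ e ∈ Ideal.span ((fun z : Y.presheaf.stalk y => z ^ p ^ e) '' (Ideal.span (Set.range s) : Set (Y.presheaf.stalk y)))) → w ∈ Ideal.span (Set.range s)) → ∃ (W' : AlgebraicGeometry.Scheme.{0}) (π : W' ⟶ Y), AlgebraicGeometry.IsProper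 π ∧ Literature.AlgebraicGeometry.Resolution.IsBirational π ∧ ∀ w : W', IsRegularLocalRing (W'.presheaf.stalk w) ∨ (IsDomain (W'.presheaf.stalk w) ∧ ∃ t : W'.presheaf.stalk w, t ∈ IsLocalRing.maximalIdeal (W'.presheaf.stalk w) ∧ t ≠ 0 ∧ IsRegularRing (Localization.Away t) ∧ ∀ d : ℕ, ringKrullDim (W'.presheaf.stalk w ⧸ Ideal.span {t}) = d → ∀ u : Fin d → W'.presheaf.stalk w ⧸ Ideal.span {t}, (Ideal.span (Set.range u)).radical.IsMaximal → RingTheory.Sequence.IsWeaklyRegular (W'.presheaf.stalk w ⧸ Ideal.span {t}) (List.ofFn u) ∧ ∀ y : W'.presheaf.stalk w ⧸ Ideal.span {t}, (∃ e : ℕ, y ^ p ^ e ∈ Ideal.span ((fun z : W'.presheaf.stalk w ⧸ Ideal.span {t} => z ^ p ^ e) '' (Ideal.span (Set.range u) : Set (W'.presheaf.stalk w ⧸ Ideal.span {t})))) → y ∈ Ideal.span (Set.range u))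

end Summit.ResolutionOfSingularities.ResolutionOfSingularities.Cruxes.FRationalModification.Promote
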